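import Summits.AtomisticToContinuum.HydrodynamicLimit.Theses.ImplosionDichotomy
import Literature.Analysis.FluidPDE.CompressibleEulerImplosion

/-!
# The `SS(r₂)` seed profile of the Kidder knob family (line `kidder-knob-melnikov`, stub 2)

Helper file (`--supports stmt-AtomisticToContinuum-12586`) for the registered stub
`stub_kidderKnob : KidderKnob` (`KidderKnob := ProjectiveCovariance → Nonempty KnobFamily`) of the
line `Cruxes/DenseExcursion/Lines/kidder-knob-melnikov.lean` of the crux
`ImplosionDichotomy.DenseExcursion`.

The `σ = 0` input of the whole line is the first smooth, spherically symmetric, exactly self-similar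
implosion `SS(r₂)` of the MONATOMIC ideal gas (`γ = 5/3`): Buckmaster–Cao-Labora–Gómez-Serrano,
*Smooth imploding solutions for 3D compressible fluids*, Forum Math. Pi 13 (2025) =
arXiv:2208.09445, Theorem 1.1 (`Literature.Analysis.FluidPDE.CaolaboraEtAl2025_thm12_euler`, the
Cao-Labora–Gómez-Serrano–Shi–Staffilani `𝕋³` implosion WITHOUT a profile, is too weak for the
exact self-similarity clause `KnobFamily.selfSimilar`). This file

* consumes that theorem, at `γ = 5/3`, through the NAMED FACT
  `Literature.Analysis.FluidPDE.BuckmasterCaolaboraGomezserrano2025_thm11_monatomic` (filed from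
  this seat: radial velocity / rescaled-sound-speed profiles `(U, S)` of the self-similar variable
  `ζ = R/(T−t)^{1/r}`, smooth as fields on `ℝ³`, solving the profile system, `S > 0`, ending at
  `P_∞`, with the paper's certified window `r ∈ (r₃(5/3), r₄(5/3)) ⊂ (1.10102, 1.13476)`);
* PROVES from it the profile part of the interface `KnobFamily` in the skeleton's normalisation
  (`exists_knobProfile`): a speed `r` with `11/10 < r < 227/200` (field `hr`) and profiles
  `Pf = (S/3r)³` (density), `Uf = U/r` (radial velocity), `Qf = (3/5) Pf^{2/3} = S²/(15 r²)`
  (temperature) which are smooth as fields on `ℝ³`, positive (`profilePos`), isentropic with the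
  monatomic adiabat `θ = k ρ^{2/3}`, `k = 3/5` (`isentropic`), and solve, for `ζ > 0`, the three
  reduced equations obtained by inserting the ansatz of `KnobFamily.selfSimilar`,
  `ρ = (T−t)^{−3(1−1/r)} Pf(ζ)`, `u = (T−t)^{1/r−1} Uf(ζ) ŷ`, `θ = (T−t)^{2(1/r−1)} Qf(ζ)`,
  into the full ideal-gas system `IsHardSphereEulerSolution 0` (`p = ρθ`, `e = 3θ/2`) in radial
  form — continuity, radial momentum, temperature:
  `3(1−1/r) P + (ζ/r + U_f) P′ + P (U_f′ + 2U_f/ζ) = 0`,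
  `(1−1/r) U_f + (ζ/r + U_f) U_f′ + Q′ + Q P′/P = 0`,
  `2(1−1/r) Q + (ζ/r + U_f) Q′ + (2/3) Q (U_f′ + 2U_f/ζ) = 0`
  (each residual of the physical system at `(t, R)` is `(T−t)^{-e}` times the corresponding
  left-hand side at `ζ`, `e = 4 − 3/r, 2 − 1/r, 3 − 2/r`).

What is NOT here (the stub stays open; see the lead's census): turning the profile into the torus
developments `KnobFamily.sol/selfSimilar/kidder` needs the classical Cauchy theory of
`IsHardSphereEulerSolution 0` on `𝕋³` (local existence, continuation, domain-of-dependence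
uniqueness: Kato 1975 / Majda 1984, absent from the tree) and a quantitative exterior-lifespan
estimate for the periodised, sheared seed up to the Kidder time `T/(1+bT)` of every knob member.
-/

noncomputable section

open Set Filter Topology
open scoped ContDiff

namespace Summit.AtomisticToContinuum.HydrodynamicLimit.Theorems.KidderKnobMelnikov

open Literature.MathematicalPhysics.KineticTheory (V3)

/-! The named fact
`Literature.Analysis.FluidPDE.BuckmasterCaolaboraGomezserrano2025_thm11_monatomic`
(Buckmaster–Cao-Labora–Gómez-Serrano 2025, Thm 1.1 at `γ = 5/3`: the smooth radial profiles
`(r, U, S)`, window `1.10102 < r < 1.13476`, profile equations, `S > 0`, end point `P_∞`) was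
filed from this seat and lives in `Literature/Analysis/FluidPDE/CompressibleEulerImplosion.lean`. -/

/-! ## Radial profiles seen along a ray -/

/-- `|ζ e₀| = ζ` for `ζ ≥ 0`. [folklore] -/
theorem norm_smul_unitVec {ζ : ℝ} (hζ : 0 ≤ ζ) : ‖ζ • (EuclideanSpace.single 0 1 : V3)‖ = ζ := by
  rw [norm_smul, PiLp.norm_single, norm_one, mul_one, Real.norm_of_nonneg hζ]

/-- The first coordinate of `c e₀` is `c`. [folklore] -/
theorem smul_unitVec_apply_zero (c : ℝ) : (c • (EuclideanSpace.single 0 1 : V3)) 0 = c := by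
  simp

/-- A radial scalar field `y ↦ S(|y|)` smooth on `ℝ³` has a profile `S` differentiable at every
`ζ > 0` (restrict to the ray `ζ ↦ ζ e₀`). [folklore] -/
theorem differentiableAt_of_radialScalar {S : ℝ → ℝ}
    (hS : ContDiff ℝ ∞ (fun y : V3 => S ‖y‖)) {ζ : ℝ} (hζ : 0 < ζ) : DifferentiableAt ℝ S ζ := by
  have hg : ContDiff ℝ ∞ (fun x : ℝ => S ‖x • (EuclideanSpace.single 0 1 : V3)‖) :=
    hS.comp (contDiff_id.smul contDiff_const)
  refine (hg.differentiable (by simp)).differentiableAt.congr_of_eventuallyEq ?_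
  filter_upwards [Ioi_mem_nhds hζ] with x hx
  simp only [norm_smul_unitVec (le_of_lt hx)]

/-- A radial vector field `y ↦ U(|y|) y/|y|` smooth on `ℝ³` has a profile `U` differentiable at
every `ζ > 0` (first coordinate along the ray `ζ ↦ ζ e₀`). [folklore] -/
theorem differentiableAt_of_radialField {U : ℝ → ℝ}
    (hU : ContDiff ℝ ∞ (fun y : V3 => (U ‖y‖ / ‖y‖) • y)) {ζ : ℝ} (hζ : 0 < ζ) :
    DifferentiableAt ℝ U ζ := by
  have hg : ContDiff ℝ ∞ (fun x : ℝ =>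
      ((U ‖x • (EuclideanSpace.single 0 1 : V3)‖ / ‖x • (EuclideanSpace.single 0 1 : V3)‖) •
        (x • (EuclideanSpace.single 0 1 : V3))) 0) :=
    (EuclideanSpace.proj (0 : Fin 3)).contDiff.comp (hU.comp (contDiff_id.smul contDiff_const))
  refine (hg.differentiable (by simp)).differentiableAt.congr_of_eventuallyEq ?_
  filter_upwards [Ioi_mem_nhds hζ] with x hx
  rw [smul_smul, smul_unitVec_apply_zero, norm_smul_unitVec (le_of_lt hx),
    div_mul_cancel₀ _ (ne_of_gt hx)]

/-! ## The knob-family profile from the named fact -/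

/-- **The `SS(r₂)` seed profile in the normalisation of `KnobFamily`.** From the
Buckmaster–Cao-Labora–Gómez-Serrano profile `(r, U, S)` of the monatomic gas put
`Pf = (S/3r)³` (density: `ρ = (ασ)^{1/α} = (σ/3)³`, `σ = r⁻¹(T−t)^{1/r−1}S`), `Uf = U/r`
(`u = (T−t)^{1/r−1} Uf(ζ) ŷ`) and `Qf = S²/(15r²) = (3/5)Pf^{2/3}` (`p = ρ^{5/3}/γ = ρθ`). Then:
`11/10 < r < 227/200`; the fields `y ↦ Pf(|y|)`, `y ↦ Uf(|y|) y/|y|`, `y ↦ Qf(|y|)` are smooth on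
`ℝ³`; `Pf, Qf > 0` on `[0,∞)`; `Qf = (3/5) Pf^{2/3}` there; and for `ζ > 0` the reduced continuity,
radial-momentum (`p = ρθ`) and monatomic temperature (`e = 3θ/2`) equations of the self-similar
ansatz `ρ = (T−t)^{−3(1−1/r)}Pf(ζ)`, `u = (T−t)^{1/r−1}Uf(ζ)ŷ`, `θ = (T−t)^{2(1/r−1)}Qf(ζ)`,
`ζ = R/(T−t)^{1/r}`, hold:
`3(1−1/r)P + (ζ/r + U_f)P′ + P(U_f′ + 2U_f/ζ) = 0`,
`(1−1/r)U_f + (ζ/r + U_f)U_f′ + Q′ + Q P′/P = 0`,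
`2(1−1/r)Q + (ζ/r + U_f)Q′ + (2/3)Q(U_f′ + 2U_f/ζ) = 0`;
finally `Uf(ζ)/ζ → 0` and `Qf(ζ)/ζ² → 0` as `ζ → ∞` (the end point `P_∞`). These are the fields
`r, Pf, Uf, Qf` and the clauses `hr, profilePos, isentropic` of `KnobFamily`, and the profile
identities behind `selfSimilar`. [cite: BuckmasterCaolaboraGomezserrano2025, Thm 1.1] -/
theorem exists_knobProfile :
    Literature.Analysis.FluidPDE.BuckmasterCaolaboraGomezserrano2025_thm11_monatomic →
    ∃ (r : ℝ) (Pf Uf Qf : ℝ → ℝ),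
      (11 / 10 < r ∧ r < 227 / 200) ∧
      ContDiff ℝ ∞ (fun y : V3 => Pf ‖y‖) ∧
      ContDiff ℝ ∞ (fun y : V3 => (Uf ‖y‖ / ‖y‖) • y) ∧
      ContDiff ℝ ∞ (fun y : V3 => Qf ‖y‖) ∧
      (∀ ζ, 0 ≤ ζ → 0 < Pf ζ ∧ 0 < Qf ζ) ∧
      (∃ k : ℝ, 0 < k ∧ ∀ ζ, 0 ≤ ζ → Qf ζ = k * Pf ζ ^ (2 / 3 : ℝ)) ∧
      (∀ ζ, 0 < ζ →
        3 * (1 - 1 / r) * Pf ζ + (ζ / r + Uf ζ) * deriv Pf ζ +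
            Pf ζ * (deriv Uf ζ + 2 * Uf ζ / ζ) = 0 ∧
        (1 - 1 / r) * Uf ζ + (ζ / r + Uf ζ) * deriv Uf ζ + deriv Qf ζ +
            Qf ζ * deriv Pf ζ / Pf ζ = 0 ∧
        2 * (1 - 1 / r) * Qf ζ + (ζ / r + Uf ζ) * deriv Qf ζ +
            2 / 3 * Qf ζ * (deriv Uf ζ + 2 * Uf ζ / ζ) = 0) ∧
      Tendsto (fun ζ => Uf ζ / ζ) atTop (𝓝 0) ∧ Tendsto (fun ζ => Qf ζ / ζ ^ 2) atTop (𝓝 0) := by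
  rintro ⟨r, hr₃, hr₄, U, S, hU3, hS3, hode, hSpos, hUinf, hSinf⟩
  have hr : 0 < r := by linarith
  have hr0 : r ≠ 0 := hr.ne'
  refine ⟨r, fun ζ => (S ζ / (3 * r)) ^ 3, fun ζ => U ζ / r, fun ζ => S ζ ^ 2 / (15 * r ^ 2),
    ⟨by linarith, by linarith⟩, ?_, ?_, ?_, ?_, ?_, ?_, ?_, ?_⟩
  · -- smooth density field
    exact (hS3.div_const (3 * r)).pow 3
  · -- smooth velocity field: `(U/r/|y|) y = r⁻¹ • ((U/|y|) y)`
    have : (fun y : V3 => (U ‖y‖ / r / ‖y‖) • y) = fun y => r⁻¹ • ((U ‖y‖ / ‖y‖) • y) := by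
      funext y
      rw [smul_smul]
      congr 1
      ring
    rw [this]
    exact hU3.const_smul r⁻¹
  · -- smooth temperature field
    exact (hS3.pow 2).div_const (15 * r ^ 2)
  · -- positivity
    intro ζ hζ
    have hS := hSpos ζ hζ
    exact ⟨by positivity, by positivity⟩
  · -- isentropic, `k = 3/5`
    refine ⟨3 / 5, by norm_num, fun ζ hζ => ?_⟩
    have hx : 0 ≤ S ζ / (3 * r) := by
      have := hSpos ζ hζ
      positivity
    have hpow : ((S ζ / (3 * r)) ^ 3) ^ (2 / 3 : ℝ) = (S ζ / (3 * r)) ^ 2 := by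
      rw [← Real.rpow_natCast _ 3, ← Real.rpow_mul hx]
      norm_num
    simp only [hpow]
    field_simp
    ring
  · -- the three reduced equations
    intro ζ hζ
    have hζ0 : ζ ≠ 0 := hζ.ne'
    obtain ⟨h1, h2⟩ := hode ζ hζ
    have hSζ : 0 < S ζ := hSpos ζ hζ.le
    have hS0 : S ζ ≠ 0 := hSζ.ne'
    have hUd : DifferentiableAt ℝ U ζ := differentiableAt_of_radialField hU3 hζ
    have hSd : DifferentiableAt ℝ S ζ := differentiableAt_of_radialScalar hS3 hζ
    -- derivatives of the three profiles at `ζ`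
    have hP : HasDerivAt (fun x => (S x / (3 * r)) ^ 3)
        (((3 : ℕ) : ℝ) * (S ζ / (3 * r)) ^ (3 - 1) * (deriv S ζ / (3 * r))) ζ :=
      (hSd.hasDerivAt.div_const (3 * r)).pow 3
    have hP' : deriv (fun x => (S x / (3 * r)) ^ 3) ζ =
        3 * (S ζ / (3 * r)) ^ 2 * (deriv S ζ / (3 * r)) := by
      rw [hP.deriv]
      norm_num
    have hU' : deriv (fun x => U x / r) ζ = deriv U ζ / r := (hUd.hasDerivAt.div_const r).deriv
    have hQ : HasDerivAt (fun x => S x ^ 2 / (15 * r ^ 2))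
        (((2 : ℕ) : ℝ) * S ζ ^ (2 - 1) * deriv S ζ / (15 * r ^ 2)) ζ :=
      (hSd.hasDerivAt.pow 2).div_const (15 * r ^ 2)
    have hQ' : deriv (fun x => S x ^ 2 / (15 * r ^ 2)) ζ = 2 * S ζ * deriv S ζ / (15 * r ^ 2) := by
      rw [hQ.deriv]
      norm_num
    have hP0 : (S ζ / (3 * r)) ^ 3 ≠ 0 := by positivity
    refine ⟨?_, ?_, ?_⟩
    · rw [hP', hU']
      have key : 3 * (1 - 1 / r) * (S ζ / (3 * r)) ^ 3 +
            (ζ / r + U ζ / r) * (3 * (S ζ / (3 * r)) ^ 2 * (deriv S ζ / (3 * r))) +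
            (S ζ / (3 * r)) ^ 3 * (deriv U ζ / r + 2 * (U ζ / r) / ζ) =
          S ζ ^ 2 / (9 * r ^ 4) *
            ((r - 1) * S ζ + (ζ + U ζ) * deriv S ζ + 1 / 3 * S ζ * (deriv U ζ + 2 * U ζ / ζ)) := by
        field_simp
        ring
      rw [key, h2, mul_zero]
    · rw [hP', hU', hQ']
      have key : (1 - 1 / r) * (U ζ / r) + (ζ / r + U ζ / r) * (deriv U ζ / r) +
            2 * S ζ * deriv S ζ / (15 * r ^ 2) +
            S ζ ^ 2 / (15 * r ^ 2) * (3 * (S ζ / (3 * r)) ^ 2 * (deriv S ζ / (3 * r))) /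
              (S ζ / (3 * r)) ^ 3 =
          1 / r ^ 2 * ((r - 1) * U ζ + (ζ + U ζ) * deriv U ζ + 1 / 3 * S ζ * deriv S ζ) := by
        field_simp
        ring
      rw [key, h1, mul_zero]
    · rw [hU', hQ']
      have key : 2 * (1 - 1 / r) * (S ζ ^ 2 / (15 * r ^ 2)) +
            (ζ / r + U ζ / r) * (2 * S ζ * deriv S ζ / (15 * r ^ 2)) +
            2 / 3 * (S ζ ^ 2 / (15 * r ^ 2)) * (deriv U ζ / r + 2 * (U ζ / r) / ζ) =
          2 * S ζ / (15 * r ^ 3) *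
            ((r - 1) * S ζ + (ζ + U ζ) * deriv S ζ + 1 / 3 * S ζ * (deriv U ζ + 2 * U ζ / ζ)) := by
        field_simp
      rw [key, h2, mul_zero]
  · -- `Uf/ζ → 0`
    have h0 : Tendsto (fun ζ => U ζ / ζ / r) atTop (𝓝 (0 / r)) := hUinf.div_const r
    rw [zero_div] at h0
    refine h0.congr' (Eventually.of_forall fun ζ => ?_)
    show U ζ / ζ / r = U ζ / r / ζ
    ring
  · -- `Qf/ζ² → 0`
    have h2 : Tendsto (fun ζ => (S ζ / ζ) ^ 2 / (15 * r ^ 2)) atTop (𝓝 (0 ^ 2 / (15 * r ^ 2))) :=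
      (hSinf.pow 2).div_const _
    rw [zero_pow two_ne_zero, zero_div] at h2
    refine h2.congr' ?_
    filter_upwards [eventually_gt_atTop 0] with ζ hζ
    field_simp

/-! ## Smoothness of exactly self-similar fields before the blow-up time -/

/-- **Exactly self-similar space–time fields are smooth before the blow-up time.** If `F : ℝ³ → G`
is smooth then `(t, y) ↦ (T − t)^p · F((T − t)^q y)` is jointly smooth on `{t < T} × ℝ³` (real
powers of the positive function `T − t`). With `F = Pf(|·|)`, `p = −3(1−1/r)`, `q = −1/r` this is
the density of `KnobFamily.selfSimilar`, with `F` the radial velocity field and `p = 1/r − 1` the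
velocity (`selfSimilar_velocity_eq`), with `F = Qf(|·|)`, `p = 2(1/r−1)` the temperature
(`norm_rpow_neg_smul` rewrites `|(T−t)^{−1/r} y| = |y|/(T−t)^{1/r}`). [folklore] -/
theorem contDiffOn_selfSimilarField {G : Type*} [NormedAddCommGroup G] [NormedSpace ℝ G]
    {F : V3 → G} (hF : ContDiff ℝ ∞ F) (T p q : ℝ) :
    ContDiffOn ℝ ∞ (fun z : ℝ × V3 => (T - z.1) ^ p • F (((T - z.1) ^ q) • z.2))
      (Iio T ×ˢ univ) := by
  have hsub : ContDiffOn ℝ ∞ (fun z : ℝ × V3 => T - z.1) (Iio T ×ˢ univ) :=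
    (contDiff_const.sub contDiff_fst).contDiffOn
  have hne : ∀ z ∈ Iio T ×ˢ (univ : Set V3), T - z.1 ≠ 0 := fun z hz =>
    (sub_pos.2 (mem_Iio.1 (mem_prod.1 hz).1)).ne'
  exact (hsub.rpow_const_of_ne hne).smul
    (hF.comp_contDiffOn ((hsub.rpow_const_of_ne hne).smul contDiff_snd.contDiffOn))

/-- `|(T − t)^{−1/r} y| = |y| / (T − t)^{1/r}` for `t < T`. [folklore] -/
theorem norm_rpow_neg_smul {T t : ℝ} (ht : t < T) (r : ℝ) (y : V3) :
    ‖((T - t) ^ (-(1 / r))) • y‖ = ‖y‖ / (T - t) ^ (1 / r) := by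
  have hTt : 0 < T - t := sub_pos.2 ht
  rw [norm_smul, Real.norm_of_nonneg (Real.rpow_nonneg hTt.le _), Real.rpow_neg hTt.le,
    inv_mul_eq_div]

/-- The velocity of `KnobFamily.selfSimilar` is `(T−t)^{1/r−1}` times the radial profile field
`y ↦ Uf(|y|) y/|y|` evaluated at `(T−t)^{−1/r} y`. [folklore] -/
theorem selfSimilar_velocity_eq (Uf : ℝ → ℝ) {T t : ℝ} (ht : t < T) (r : ℝ) (y : V3) :
    ((T - t) ^ (1 / r - 1) * Uf (‖y‖ / (T - t) ^ (1 / r)) / ‖y‖) • y =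
      (T - t) ^ (1 / r - 1) •
        (fun y' : V3 => (Uf ‖y'‖ / ‖y'‖) • y') (((T - t) ^ (-(1 / r))) • y) := by
  have hTt : 0 < T - t := sub_pos.2 ht
  by_cases hy : y = 0
  · simp [hy]
  · have hy' : ‖y‖ ≠ 0 := norm_ne_zero_iff.2 hy
    have hpow : (T - t) ^ (1 / r) ≠ 0 := (Real.rpow_pos_of_pos hTt _).ne'
    simp only [norm_rpow_neg_smul ht, smul_smul]
    congr 1
    rw [Real.rpow_neg hTt.le]
    field_simp

end Summit.AtomisticToContinuum.HydrodynamicLimit.Theorems.KidderKnobMelnikov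

end
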